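import Literature.AlgebraicGeometry.Resolution.BlowupAlgebraStrictTransform
import Mathlib.RingTheory.LocalRing.RingHom.Basic
import HarnessLib

/-!
# [OURS · L1 W4.5(b) · EL♮] DEAD-PINCH: a legal centre `C` through a point `P` of the avatar with `ϖ ∈ I_C + 𝔪_P·I_Z̃` makes EVERY point of
# the new avatar over `P` non-liftable — ring form on the affine blow-up chart `A[I_C/w]` (LIFT-50 Layer 0, memo LIFT50-CORE.md §2;
# crux `EquisingularLiftNat` = stmt-ResolutionOfSingularities-20038; PARENT ≥ 4 band / kill test #50 K5-BMY; object (ε))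

HONEST FRAMING. OURS (cell res-hironaka, crux chain w45b, slot W4.5(b)); NOT a statement of any manuscript; replaces the role of NOTHING
in the manuscript; AI-written, AI review is weaker than expert review. Helper `--supports stmt-ResolutionOfSingularities-20038 --as helper`.
Companion of `…NatLiftCoreLocal` (p569735: a regular `O`-flat local lift of `X` through `x` exists only if `ϖ ∉ 𝔪_x·I_{X,x}`, and
`ϖ ∈ 𝔪 I` persists upward). Memo `L/res-L1-w45b-lead-1/LIFT50-CORE.md` §2 (res-L1-w45b-lead-1 gen 8).

THE SITUATION. `A = 𝒪_{P_i,P}` at a point `P` of the avatar `Z̃ = V(I_Z)` (`ϖ ∈ I_Z`), `C = V(I_C)` a legal centre through `P`, `w ∈ I_C` the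
equation of the exceptional divisor on the chart `D₊(w)` of `Bl_C`, whose coordinate ring is the tree's affine blow-up algebra `B = A[I_C/w]`
(`blowupAlgebra I_C w`, Görtz–Wedhorn (13.19)). The strict transform `Z̃″` of the avatar on this chart is cut out by the kernel of
`blowupAlgebraMap (A → A/I_Z) I_C (I_C·(A/I_Z)) w` (tree `BlowupAlgebraStrictTransform`: the `w`-saturation of `I_Z·B`). THE THEOREMS:

* `algebraMap_mem_mul_ker_of_mem_sup` — **DEAD-PINCH, chart form**: `ϖ ∈ I_C + 𝔪·I_Z` (any ideal `𝔪`, e.g. `𝔪_P`) ⟹ in `B`,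
  `ϖ ∈ (𝔪 B + w B) · I_{Z̃″}`. Proof: `ϖ = c + g`, `c ∈ I_C ∩ I_Z`, `g ∈ 𝔪 I_Z`; on the chart `c = w·(c/w)` with `w·(c/w) = c ∈ I_Z B`, so `c/w` lies in
  the saturation `I_{Z̃″}`; and `g ∈ 𝔪B·I_ZB ⊆ 𝔪B·I_{Z̃″}`.
* `map_mem_mul_of_mem_mul_of_map_le` — transport to a local ring `L` (the stalk `𝒪_{P_{i+1},x″}` at a point `x″` of the chart lying on the
  exceptional divisor over `P`: `𝔪_P ↦ 𝔪_{x″}`, `w ↦ 𝔪_{x″}`) and to any ideal `I″ ⊇ I_{Z̃″}L`: `ϖ ∈ 𝔪_{x″}·I″`. With `LiftCore.not_mem_mul_of_sup_span_eq`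
  and persistence: **no regular `O`-flat subscheme of any later stage has the avatar as special fibre near a point over `P`** — the pinch is dead
  for pure noses for ever.
* `mem_sup_mul_iff_mk_mem` — the hypothesis read in the centre: `ϖ ∈ I_C + 𝔪 I_Z ⟺` in `𝒪_{C,P} = A/I_C`, `ϖ ∈ 𝔪_C·(I_Z 𝒪_C)`, i.e. `ϖ` is NOT a
  minimal generator of the ideal of `C ∩ Z̃` in `C` (for a relative curve with planar special fibre and trace `(x², y²)`: ⟺ `mult_P C_s ≥ 3`, by hand).
* `mem_sup_mul_of_transversal` — K2-PRICELIST §1's explicit CI pinching move: `u₀ = F₂ + ϖ·e ∈ I_C` with `F₂ ∈ I_Z²` (the hypersurface is singular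
  along the avatar) and `e` a unit (needed for `C` to be regular at `P`) ⟹ `ϖ ∈ I_C + 𝔪 I_Z` whenever `I_Z ≤ 𝔪` — so that move is DEAD: the (E-nn)
  door as realised in K2 §1 is VOID (LIFT50-CORE §2, correction of record to K2 §2 (i)).

References: Görtz–Wedhorn, Algebraic Geometry I, (13.19) and Prop. 13.96 [GortzWedhorn2020] (tree `AffineBlowupAlgebra`, `BlowupStrictTransform`,
`BlowupAlgebraStrictTransform`); memo LIFT50-CORE.md §2–§3. [folklore]
-/

set_option linter.dupNamespace false -- mandated namespace `Summit.<Summit>.<Problem>` of this single-conjunct summit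

universe u

open IsLocalRing
open Literature.AlgebraicGeometry.Resolution

namespace Summit.ResolutionOfSingularities.ResolutionOfSingularities.Cruxes.EquisingularLiftNat.Sections

namespace DeadPinch

variable {A : Type u} [CommRing A]

/-! ## The hypothesis, read in the centre and produced by the CI pinching move -/

/-- `ϖ ∈ I_C + K ⟺ ϖ̄ ∈ K·(A/I_C)`: with `K = 𝔪·I_Z`, the DEAD-PINCH hypothesis says that in the local ring `𝒪_{C,P} = A/I_C` of the CENTRE,
`ϖ` lies in `𝔪_C · (I_Z 𝒪_C)` — it is not a minimal generator of the ideal of `C ∩ Z̃ ⊂ C`. [folklore] -/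
theorem mem_sup_mul_iff_mk_mem (I_C 𝔪 I_Z : Ideal A) (ϖ : A) :
    ϖ ∈ I_C ⊔ 𝔪 * I_Z ↔
      Ideal.Quotient.mk I_C ϖ ∈ 𝔪.map (Ideal.Quotient.mk I_C) * I_Z.map (Ideal.Quotient.mk I_C) := by
  rw [← Ideal.map_mul, Ideal.mem_quotient_iff_mem_sup, sup_comm]

/-- **K2's CI pinching move satisfies the DEAD-PINCH hypothesis.** If the centre's ideal contains `u₀ = F₂ + ϖ·e` with `F₂ ∈ I_Z²` (the
hypersurface `Y ⊃ Z̃` has multiplicity `≥ 2` along the avatar, so its lifted local equation is in `I_Z²` up to `ϖ`) and `e` a unit (forced by the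
regularity of `C` at `P`), and `I_Z ≤ 𝔪`, then `ϖ ∈ I_C + 𝔪·I_Z`. OURS. [folklore] -/
theorem mem_sup_mul_of_transversal {I_C 𝔪 I_Z : Ideal A} (hZ : I_Z ≤ 𝔪) {u₀ F₂ ϖ e : A} (hu₀ : u₀ ∈ I_C)
    (hF₂ : F₂ ∈ I_Z ^ 2) (he : IsUnit e) (heq : u₀ = F₂ + ϖ * e) : ϖ ∈ I_C ⊔ 𝔪 * I_Z := by
  have hF₂' : F₂ ∈ 𝔪 * I_Z := by
    rw [pow_two] at hF₂
    exact Ideal.mul_mono_left hZ hF₂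
  have h1 : ϖ * e ∈ I_C ⊔ 𝔪 * I_Z := by
    have : ϖ * e = u₀ - F₂ := by rw [heq]; ring
    rw [this]
    exact Ideal.sub_mem _ (Ideal.mem_sup_left hu₀) (Ideal.mem_sup_right hF₂')
  have : ϖ = (ϖ * e) * ↑he.unit⁻¹ := by
    rw [mul_assoc, IsUnit.mul_val_inv, mul_one]
  rw [this]
  exact Ideal.mul_mem_right _ _ h1

/-! ## DEAD-PINCH on the chart `A[I_C/w]` -/

/-- **DEAD-PINCH, chart form.** Let `w ∈ I_C`, `ϖ ∈ I_Z`, and `ϖ ∈ I_C + 𝔪·I_Z`. On the affine blow-up chart `B = A[I_C/w]`, with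
`I_{Z̃″} := ker (B → (A/I_Z)[I_C/w])` the ideal of the strict transform of the avatar (the `w`-saturation of `I_Z B`):
`ϖ ∈ (𝔪B + wB) · I_{Z̃″}`. OURS. [folklore] -/
theorem algebraMap_mem_mul_ker_of_mem_sup (I_C 𝔪 I_Z : Ideal A) {w ϖ : A} (hw : w ∈ I_C) (hϖZ : ϖ ∈ I_Z)
    (hϖ : ϖ ∈ I_C ⊔ 𝔪 * I_Z) :
    algebraMap A (blowupAlgebra I_C w) ϖ ∈
      (𝔪.map (algebraMap A (blowupAlgebra I_C w)) ⊔ Ideal.span {algebraMap A (blowupAlgebra I_C w) w}) *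
        RingHom.ker (blowupAlgebraMap (Ideal.Quotient.mk I_Z) I_C (I_C.map (Ideal.Quotient.mk I_Z)) w le_rfl) := by
  set B := blowupAlgebra I_C w with hB
  set q := Ideal.Quotient.mk I_Z with hq
  set K := RingHom.ker (blowupAlgebraMap q I_C (I_C.map q) w le_rfl) with hK
  set wB := algebraMap A B w with hwB
  obtain ⟨c, hc, g, hg, hcg⟩ := Submodule.mem_sup.mp hϖ
  -- `c ∈ I_Z`
  have hcZ : c ∈ I_Z := by
    have : c = ϖ - g := by rw [← hcg]; ring
    rw [this]
    exact Ideal.sub_mem _ hϖZ (Ideal.mul_le_left hg)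
  -- on the chart, `c = c' · w`
  have hcmap : algebraMap A B c ∈ Ideal.span {wB} := by
    rw [hwB, ← map_blowupAlgebra_eq_span hw]
    exact Ideal.mem_map_of_mem _ hc
  obtain ⟨c', hc'⟩ := Ideal.mem_span_singleton'.mp hcmap
  -- `c'` lies in the saturation: `w · c' = c ∈ I_Z B = (ker q) B`
  have hc'K : c' ∈ K := by
    rw [hK, mem_ker_blowupAlgebraMap_iff]
    refine ⟨1, ?_⟩
    rw [pow_one, ← hwB, mul_comm, hc', Ideal.mk_ker]
    exact Ideal.mem_map_of_mem _ hcZ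
  -- the total transform lies in the kernel
  have hZK : I_Z.map (algebraMap A B) ≤ K := by
    rw [Ideal.map_le_iff_le_comap]
    intro z hz
    rw [Ideal.mem_comap, hK, RingHom.mem_ker, blowupAlgebraMap_algebraMap, hq,
      Ideal.Quotient.eq_zero_iff_mem.mpr hz, map_zero]
  have hgmap : algebraMap A B g ∈ 𝔪.map (algebraMap A B) * K := by
    have : (𝔪 * I_Z).map (algebraMap A B) ≤ 𝔪.map (algebraMap A B) * K := by
      rw [Ideal.map_mul]
      exact Ideal.mul_mono_right hZK
    exact this (Ideal.mem_map_of_mem _ hg)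
  rw [← hcg, map_add, ← hc']
  refine Ideal.add_mem _ ?_ ?_
  · rw [show c' * wB = wB * c' from mul_comm _ _]
    exact Ideal.mul_mem_mul (Ideal.mem_sup_right (Ideal.mem_span_singleton_self _)) hc'K
  · exact Ideal.mul_mono_left le_sup_left hgmap

/-! ## Transport to the stalk at a point of the exceptional divisor -/

/-- Transport: if `x ∈ K·I` and `ψ(K) ⊆ K′`, `ψ(I) ⊆ I′` then `ψ x ∈ K′·I′`. Used with `ψ : A[I_C/w] → 𝒪_{P_{i+1},x″}` the localisation at a
point `x″` of the chart ON the exceptional divisor OVER `P` (`K = 𝔪_P B + wB ↦ 𝔪_{x″}`) and `I′ ⊇` the strict-transform ideal. [folklore] -/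
theorem map_mem_mul_of_mem_mul_of_map_le {B L : Type u} [CommRing B] [CommRing L] (ψ : B →+* L) {K I : Ideal B}
    {K' I' : Ideal L} (hK : K.map ψ ≤ K') (hI : I.map ψ ≤ I') {x : B} (hx : x ∈ K * I) : ψ x ∈ K' * I' := by
  have : (K * I).map ψ ≤ K' * I' := by
    rw [Ideal.map_mul]
    exact Ideal.mul_mono hK hI
  exact this (Ideal.mem_map_of_mem ψ hx)

/-- **DEAD-PINCH at the stalk.** In the situation of `algebraMap_mem_mul_ker_of_mem_sup`, for every local ring `L` and `ψ : A[I_C/w] → L` with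
`ψ(𝔪) ⊆ 𝔪_L` and `ψ(w) ∈ 𝔪_L` (a point of the chart on the exceptional divisor over `P`) and every ideal `I″ ⊇ ψ(I_{Z̃″})` (the strict transform
of the avatar at that point, or anything containing it): `ψ(ϖ) ∈ 𝔪_L · I″`. By `LiftCore.not_mem_mul_of_sup_span_eq` no regular `O`-flat `J ≤ I″` with
`J + (ϖ) = I″` exists, and by `LiftCore.map_mem_mul_of_mem_mul` this persists to all later stages. OURS. [folklore] -/
theorem map_mem_maximalIdeal_mul {L : Type u} [CommRing L] [IsLocalRing L] (I_C 𝔪 I_Z : Ideal A) {w ϖ : A} (hw : w ∈ I_C)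
    (hϖZ : ϖ ∈ I_Z) (hϖ : ϖ ∈ I_C ⊔ 𝔪 * I_Z) (ψ : blowupAlgebra I_C w →+* L)
    (h𝔪 : 𝔪.map ((ψ.comp (algebraMap A (blowupAlgebra I_C w)))) ≤ maximalIdeal L)
    (hwL : ψ (algebraMap A (blowupAlgebra I_C w) w) ∈ maximalIdeal L) {I'' : Ideal L}
    (hI'' : (RingHom.ker (blowupAlgebraMap (Ideal.Quotient.mk I_Z) I_C (I_C.map (Ideal.Quotient.mk I_Z)) w le_rfl)).map ψ ≤ I'') :
    ψ (algebraMap A (blowupAlgebra I_C w) ϖ) ∈ maximalIdeal L * I'' := by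
  refine map_mem_mul_of_mem_mul_of_map_le ψ ?_ hI'' (algebraMap_mem_mul_ker_of_mem_sup I_C 𝔪 I_Z hw hϖZ hϖ)
  rw [Ideal.map_sup]
  refine sup_le ?_ ?_
  · rw [Ideal.map_map]; exact h𝔪
  · rw [Ideal.map_span, Set.image_singleton]
    exact (Ideal.span_singleton_le_iff_mem _).mpr hwL

end DeadPinch

end Summit.ResolutionOfSingularities.ResolutionOfSingularities.Cruxes.EquisingularLiftNat.Sections
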